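import Mathlib
import Summits.NavierStokesRegularity.NavierStokesRegularity.Theses.CompletionRelayChain
import HarnessLib

/-!
# `CompletionRelayChain.Assembly` — the route's assembly (item stmt-NavierStokesRegularity-24855;
  pure logic)

**Statement.** `RelayTable → RelayFrontStep → RestartControl → RestartGlue →
LocalDynamicsSufficesAt → TaoLadderRungThree.TargetR64`.

PROOF. The route file `Theses/CompletionRelayChain.lean` carries the planner-authored,
kernel-checked deciding theorem `Theses.CompletionRelayChain.closes`, whose hypotheses are exactly
the route's two cruxes and three supports and whose conclusion is the rung leaf
`TaoLadderRungThree.TargetR64` (TL-M3-R64, D-0061); the assembly item is that implication written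
as ONE proposition, so it is closed by applying `closes` to the hypotheses.

HONEST FRAMING: glue between the route's own statements about a MODEL lattice (Tao 2016's cascade
with a completion-armed relay table); nothing here is a statement about the Navier–Stokes
equations, and the rung leaf is not the summit Statement.
-/

noncomputable section

set_option linter.dupNamespace false

namespace Summit.NavierStokesRegularity.NavierStokesRegularity.Theorems

open Summit.NavierStokesRegularity.NavierStokesRegularity.Theses.CompletionRelayChain in
/-- **Item stmt-NavierStokesRegularity-24855** (`CompletionRelayChain.Assembly`): the route's two
cruxes and three supports imply its rung leaf `TaoLadderRungThree.TargetR64`, by the route file's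
deciding theorem `closes`. [this file] -/
theorem completionRelayChain_assembly_proof :
    Summit.NavierStokesRegularity.NavierStokesRegularity.Theses.CompletionRelayChain.Assembly := by
  unfold Summit.NavierStokesRegularity.NavierStokesRegularity.Theses.CompletionRelayChain.Assembly
  intro h₁ h₂ h₃ h₄ h₅
  exact closes h₁ h₂ h₃ h₄ h₅

end Summit.NavierStokesRegularity.NavierStokesRegularity.Theorems

end
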